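import Literature.NumberTheory.EllipticCurves.SexticTwistThetaDictionary
import Literature.NumberTheory.EllipticCurves.SexticTwistHeckeCoefficientsGoodTwo
import Literature.NumberTheory.EllipticCurves.Voight2007.RingClassGenusFieldProofs
import HarnessLib

/-!
# The theta dictionary for `y² = x³ + 16u`, `u ≡ 1 (4)` (the class with good reduction at `2`)

Topic `Literature/NumberTheory/EllipticCurves`, namespace `Literature.NumberTheory.EllipticCurves.SexticTwist` (sequel to
`SexticTwistThetaDictionary` and `SexticTwistHeckeCoefficientsGoodTwo`).  Theorems only (no definition, no named fact).

For `k = 16u`, `u ≡ 1 (mod 4)`, sixth-power-free, the weight of the generic dictionary (`SexticTwistThetaDictionary`, parameter `4k`,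
Jacobi symbol `(k/·)`) is replaced by

  `W′(x) = 𝟙[x ≡ 1 (3)] · c(N x) · (u/N x) · ν_u((x))`,  `ν_u = grossenNu u 1 0`,

whose support now contains the even primary elements (`ν_u((2)) = 1`, `ϖ_{(2)} = −2`): by `lFunction_eq_jacobiSym_mul_sum_of_eq_sixteen_mul`,
`Σ_{N x = n, x ≡ 1 (3)} W′(x) e(x) = c(n) a_n(E^k)`.  The only new point is the periodicity of the Jacobi factor at EVEN norms
(`N x = 4^a n′`, `2` being inert): for `u ≡ 1 (mod 4)` one has `(u/N x) = (N x/|u|)` for every `x ≠ 0` (`jacobiSym_absNorm_flip`: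
quadratic reciprocity for the odd part, `(u/4) = (4/|u|) = 1`), which is periodic in `N x` modulo `|u|`.  Results:
`weight_periodic_good` (period `36|u|m`), `isIntegral_weight_good`, `sum_normEq_weight_good_eq`, ★ `lSeries_twist_eq_thetaLFunction_good`
— the dictionary `Σ c(n) a_n(E^{16u}) n⁻ˢ = (4^s/2) Θ-L_{2M}(Φ♯)(s)` (`re s > 3/2`, `M = 36|u|m`) exactly as in the generic case.

## References
* K. Ireland, M. Rosen, *A Classical Introduction to Modern Number Theory*, 2nd ed., GTM 84 (1990), Ch. 18 §7, §6 Theorem 7, §5 Theorem 6;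
  Ch. 5 §2 (quadratic reciprocity for the Jacobi symbol). [IrelandRosen1990]
* E. Hecke, *Eine neue Art von Zetafunktionen …* II, Math. Z. 6 (1920), §9. [Hecke1920]

## Mathlib / tree search
Tree: `SexticTwist.{lFunction_eq_jacobiSym_mul_sum_of_eq_sixteen_mul, sum_idealsOfNorm_eq_sum_primary, grossenNu_eq_zero_of_not_isCoprime_three,
lSeries_coeff_parityLift, absNorm_span_mkInt_cast, normForm_add_mul, two_dvd_of_even_normForm, mem_filter_normForm}`,
`EisensteinGrossen.{psi_span_eq_of_sub_mem, isCoprime_of_sub_mem, ne_zero_of_sub_mem, grossenNu_apply, psi_pow_three, absNorm_span_natCast,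
primGen_span_singleton}`, `K3.{mkInt, exists_eq_mkInt, mkInt_mul, mkInt_add, mkInt_intCast}`, `BinaryTheta.thetaLFunction_eq_LSeries`,
`QuadOrder.parityLift_periodic`.  Mathlib: `jacobiSym.{quadratic_reciprocity, quadratic_reciprocity_one_mod_four, neg, mul_right', pow_right,
mul_left, pow_left, sq_one', mod_left, legendreSym.to_jacobiSym}`, `legendreSym.mod/at_one`; tree `jacobiSym_eq_jacobiSym_natAbs_of_emod_four_eq_one` (Voight2007).
-/

noncomputable section

open scoped Classical

open NumberField IsDedekindDomain Finset Complex
open Literature.NumberTheory.NumberFields Literature.NumberTheory.NumberFields.K3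
open Literature.NumberTheory.GaloisRepresentations
open Literature.NumberTheory.LFunctions Literature.NumberTheory.LFunctions.NumberField
open Literature.NumberTheory.LFunctions.EisensteinGrossen Literature.NumberTheory.LFunctions.PlaneLattice

namespace Literature.NumberTheory.EllipticCurves

namespace SexticTwist

/-! ### §1 `(u/N x) = (N x/|u|)` for `u ≡ 1 (4)` -/

section Flip

/-- Norms from `ℤ[ω]` are `4^a ·(odd)`: the prime `2` is inert. [cite: IrelandRosen1990, Ch. 9 §1 Prop. 9.1.4] -/
theorem absNorm_eq_four_pow_mul_odd {x : 𝓞 K3} (hx : x ≠ 0) :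
    ∃ (a n' : ℕ), Odd n' ∧ Ideal.absNorm (Ideal.span {x}) = 4 ^ a * n' := by
  -- strong induction on the norm
  suffices H : ∀ N : ℕ, ∀ x : 𝓞 K3, x ≠ 0 → Ideal.absNorm (Ideal.span {x}) = N → ∃ (a n' : ℕ), Odd n' ∧ N = 4 ^ a * n' by
    obtain ⟨a, n', h, e⟩ := H _ x hx rfl
    exact ⟨a, n', h, e⟩
  intro N
  induction N using Nat.strong_induction_on with
  | _ N ih =>
    intro x hx hN
    rcases Nat.even_or_odd N with heven | hodd
    · obtain ⟨a, b, rfl⟩ := exists_eq_mkInt x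
      have h2 : (2 : ℤ) ∣ a ^ 2 - a * b + b ^ 2 := by
        rw [← absNorm_span_mkInt_cast, hN]; exact_mod_cast heven.two_dvd
      obtain ⟨x₁, hx₁⟩ := two_dvd_of_even_normForm h2
      have hx₁0 : x₁ ≠ 0 := by rintro rfl; exact hx (by rw [hx₁, mul_zero])
      have hN4 : N = 4 * Ideal.absNorm (Ideal.span {x₁}) := by
        rw [← hN, hx₁, ← Ideal.span_singleton_mul_span_singleton, map_mul,
          show (2 : 𝓞 K3) = (((2 : ℕ) : ℤ) : 𝓞 K3) by push_cast; rfl, EisensteinGrossen.absNorm_span_natCast]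
        norm_num
      have hpos : 0 < Ideal.absNorm (Ideal.span {x₁}) := by
        rw [pos_iff_ne_zero, Ne, Ideal.absNorm_eq_zero_iff, Ideal.span_singleton_eq_bot]; exact hx₁0
      obtain ⟨a', n', hn', e⟩ := ih _ (by omega) x₁ hx₁0 rfl
      exact ⟨a' + 1, n', hn', by rw [hN4, e]; ring⟩
    · exact ⟨0, N, hodd, by ring⟩

/-- ★ **`(u/N x) = (N x/|u|)` for `u ≡ 1 (mod 4)` and every `x ≠ 0` in `ℤ[ω]`** (`N x = 4^a n′` with `n′` odd; `(u/4) = 1 = (4/|u|)`;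
quadratic reciprocity for the odd part — the tree's `jacobiSym_eq_jacobiSym_natAbs_of_emod_four_eq_one`). [cite: IrelandRosen1990, Ch. 5 §2 Theorem 1; Ch. 9 §1 Prop. 9.1.4] -/
theorem jacobiSym_absNorm_flip {u : ℤ} (hu4 : u % 4 = 1) {x : 𝓞 K3} (hx : x ≠ 0) :
    jacobiSym u (Ideal.absNorm (Ideal.span {x})) = jacobiSym (Ideal.absNorm (Ideal.span {x}) : ℕ) u.natAbs := by
  obtain ⟨a, n', hn', hN⟩ := absNorm_eq_four_pow_mul_odd hx
  have hu2 : jacobiSym u 2 = 1 := by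
    haveI : Fact (Nat.Prime 2) := ⟨Nat.prime_two⟩
    rw [← jacobiSym.legendreSym.to_jacobiSym, legendreSym.mod 2 u, show u % (2 : ℕ) = 1 by omega, legendreSym.at_one]
  have h4 : jacobiSym 4 u.natAbs = 1 := by
    rw [show (4 : ℤ) = 2 ^ 2 by norm_num]
    refine jacobiSym.sq_one' ?_
    rw [show (2 : ℤ) = ((2 : ℕ) : ℤ) by rfl, Int.gcd_natCast_natCast]
    exact Nat.Coprime.gcd_eq_one (Nat.coprime_two_left.mpr (Nat.odd_iff.mpr (by omega)))
  rw [hN, jacobiSym.mul_right' u (pow_ne_zero a (by norm_num)) (Nat.ne_of_odd_add hn'), jacobiSym.pow_right,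
    show (4 : ℕ) = 2 ^ 2 by norm_num, jacobiSym.pow_right, hu2, one_pow, one_pow, one_mul, jacobiSym_eq_jacobiSym_natAbs_of_emod_four_eq_one hu4 hn', Nat.cast_mul,
    jacobiSym.mul_left, Nat.cast_pow, jacobiSym.pow_left, Nat.cast_pow, show ((2 : ℕ) : ℤ) ^ 2 = 4 by norm_num, h4, one_pow, one_mul]

end Flip

/-! ### §2 The weight `W′_{u,c}`: periodicity modulo `36|u|m` and integrality -/

section Weight

variable (u : ℤ) (m : ℕ) (c : ZMod m → ℂ)

/-- **The weight `W′(x) = 𝟙[x ≡ 1 (3)] · c(N x) · (u/N x) · ν_u((x))` is periodic modulo `36|u|m`** for `u ≡ 1 (mod 4)` (the indicator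
depends on `x` mod `3`, `ν_u` on `(x)` modulo `9u` by `psi_span_eq_of_sub_mem`, `c(N x)` on `N x` mod `m`, and `(u/N x) = (N x/|u|)` on `N x` mod `|u|`).
[cite: IrelandRosen1990, Ch. 18 §6, proof of Theorem 7 («`χ(A)` depends only on `A` modulo the conductor»)] [cite: Hecke1920, §9] -/
theorem weight_periodic_good (hu4 : u % 4 = 1) [NeZero m] (x y : 𝓞 K3) :
    (fun x : 𝓞 K3 ↦ if x - 1 ∈ three then c ((Ideal.absNorm (Ideal.span {x}) : ℕ) : ZMod m) *
        (jacobiSym u (Ideal.absNorm (Ideal.span {x})) : ℂ) * grossenNu ((u : ℤ) : 𝓞 K3) 1 0 (Ideal.span {x}) else 0)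
      (x + ((36 * u.natAbs * m : ℕ) : 𝓞 K3) * y) =
    (fun x : 𝓞 K3 ↦ if x - 1 ∈ three then c ((Ideal.absNorm (Ideal.span {x}) : ℕ) : ZMod m) *
        (jacobiSym u (Ideal.absNorm (Ideal.span {x})) : ℂ) * grossenNu ((u : ℤ) : 𝓞 K3) 1 0 (Ideal.span {x}) else 0) x := by
  set D : 𝓞 K3 := ((u : ℤ) : 𝓞 K3) with hD
  set M : ℕ := 36 * u.natAbs * m with hM
  set x' : 𝓞 K3 := x + ((M : ℕ) : 𝓞 K3) * y with hx'
  have hMk : (9 * u : ℤ) ∣ (M : ℤ) := by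
    rw [hM]; push_cast
    exact (mul_dvd_mul (show (9 : ℤ) ∣ 36 from ⟨4, by norm_num⟩) (self_dvd_abs u)).mul_right _
  have h9D : x' - x ∈ Ideal.span {9 * D} := by
    obtain ⟨t, ht⟩ := hMk
    refine Ideal.mem_span_singleton'.mpr ⟨((t : ℤ) : 𝓞 K3) * y, ?_⟩
    rw [hx', hD, add_sub_cancel_left, show ((M : ℕ) : 𝓞 K3) = ((M : ℤ) : 𝓞 K3) by push_cast; rfl, ht]
    push_cast; ring
  have h3 : x' - 1 ∈ three ↔ x - 1 ∈ three := by
    have hmem : x' - x ∈ three := Ideal.span_singleton_le_span_singleton.mpr ⟨3 * D, by ring⟩ h9D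
    constructor
    · intro h; have := three.sub_mem h hmem; rwa [show x' - 1 - (x' - x) = x - 1 by ring] at this
    · intro h; have := three.add_mem h hmem; rwa [show x - 1 + (x' - x) = x' - 1 by ring] at this
  simp only
  by_cases h1 : x - 1 ∈ three
  swap
  · rw [if_neg h1, if_neg (fun h ↦ h1 (h3.mp h))]
  rw [if_pos h1, if_pos (h3.mpr h1)]
  by_cases hadm : Adm D (Ideal.span {x})
  swap
  · have hadm' : ¬ Adm D (Ideal.span {x'}) := by
      intro h'
      apply hadm
      have hsub : x - x' ∈ Ideal.span {9 * D} := by rw [← neg_sub]; exact (Ideal.span {9 * D}).neg_mem h9D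
      exact ⟨by rw [Ne, Ideal.span_singleton_eq_bot]; exact ne_zero_of_sub_mem h'.2 hsub, isCoprime_of_sub_mem h'.2 hsub⟩
    rw [grossenNu_apply, if_neg hadm', grossenNu_apply, if_neg hadm, mul_zero, mul_zero]
  have hx0 : x ≠ 0 := fun h ↦ hadm.1 (by rw [h, Ideal.span_singleton_eq_bot])
  have hx'0 : x' ≠ 0 := ne_zero_of_sub_mem hadm.2 h9D
  have hadm' : Adm D (Ideal.span {x'}) :=
    ⟨by rw [Ne, Ideal.span_singleton_eq_bot]; exact hx'0, isCoprime_of_sub_mem hadm.2 h9D⟩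
  have hν : grossenNu D 1 0 (Ideal.span {x'}) = grossenNu D 1 0 (Ideal.span {x}) := by
    rw [grossenNu_apply, if_pos hadm', grossenNu_apply, if_pos hadm, psi_span_eq_of_sub_mem D hx'0 hx0 hadm.2 h9D,
      sectorWeight, sectorWeight, pow_zero, pow_zero]
  -- norms
  obtain ⟨a, b, rfl⟩ := exists_eq_mkInt x
  obtain ⟨a', b', rfl⟩ := exists_eq_mkInt y
  have hxy : x' = mkInt (a + M * a') (b + M * b') := by
    rw [hx', show ((M : ℕ) : 𝓞 K3) = mkInt M 0 by rw [mkInt_intCast]; push_cast; rfl, mkInt_mul, mkInt_add]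
    congr 1 <;> ring
  have hN : ((Ideal.absNorm (Ideal.span {x'}) : ℕ) : ℤ) = (Ideal.absNorm (Ideal.span {mkInt a b}) : ℕ) +
      M * (2 * a * a' + M * a' ^ 2 - a * b' - a' * b - M * a' * b' + 2 * b * b' + M * b' ^ 2) := by
    rw [hxy, absNorm_span_mkInt_cast, absNorm_span_mkInt_cast, normForm_add_mul]
  have hNm : ((Ideal.absNorm (Ideal.span {x'}) : ℕ) : ZMod m) = ((Ideal.absNorm (Ideal.span {mkInt a b}) : ℕ) : ZMod m) := by
    have h := congrArg (Int.cast : ℤ → ZMod m) hN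
    push_cast at h
    rw [h, show ((M : ℕ) : ZMod m) = 0 by rw [ZMod.natCast_eq_zero_iff, hM]; exact dvd_mul_left _ _, zero_mul, add_zero]
  have hcong : ∀ d : ℕ, (d : ℤ) ∣ (M : ℤ) →
      Ideal.absNorm (Ideal.span {x'}) % d = Ideal.absNorm (Ideal.span {mkInt a b}) % d := by
    intro d hd
    obtain ⟨e, he⟩ := hd
    have h : ((Ideal.absNorm (Ideal.span {x'}) : ℕ) : ℤ) % (d : ℕ) =
        ((Ideal.absNorm (Ideal.span {mkInt a b}) : ℕ) : ℤ) % (d : ℕ) := by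
      rw [hN, he, mul_assoc, Int.add_mul_emod_self_left]
    rwa [← Int.natCast_mod, ← Int.natCast_mod, Nat.cast_inj] at h
  have hmod : Ideal.absNorm (Ideal.span {x'}) % u.natAbs = Ideal.absNorm (Ideal.span {mkInt a b}) % u.natAbs :=
    hcong u.natAbs ⟨36 * m, by rw [hM]; push_cast; ring⟩
  have hJ : jacobiSym u (Ideal.absNorm (Ideal.span {x'})) = jacobiSym u (Ideal.absNorm (Ideal.span {mkInt a b})) := by
    rw [jacobiSym_absNorm_flip hu4 hx'0, jacobiSym_absNorm_flip hu4 hx0, jacobiSym.mod_left,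
      jacobiSym.mod_left (Ideal.absNorm (Ideal.span {mkInt a b}) : ℕ), ← Int.natCast_mod, ← Int.natCast_mod, hmod]
  rw [hNm, hJ, hν]


/-- **The weight `W′` takes algebraic-integer values** when `c` does. [cite: IrelandRosen1990, Ch. 18 §6 (the values of `χ` are algebraic integers)] -/
theorem isIntegral_weight_good (hc : ∀ a, IsIntegral ℤ (c a)) (x : 𝓞 K3) :
    IsIntegral ℤ ((fun x : 𝓞 K3 ↦ if x - 1 ∈ three then c ((Ideal.absNorm (Ideal.span {x}) : ℕ) : ZMod m) *
        (jacobiSym u (Ideal.absNorm (Ideal.span {x})) : ℂ) * grossenNu ((u : ℤ) : 𝓞 K3) 1 0 (Ideal.span {x}) else 0) x) := by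
  simp only
  split_ifs with h1
  · refine ((hc _).mul ?_).mul ?_
    · rw [show ((jacobiSym u (Ideal.absNorm (Ideal.span {x})) : ℤ) : ℂ) =
        algebraMap ℤ ℂ (jacobiSym u (Ideal.absNorm (Ideal.span {x}))) from (eq_intCast _ _).symm]
      exact isIntegral_algebraMap
    · rw [grossenNu_apply]
      split_ifs with hadm
      · rw [pow_one, sectorWeight, pow_zero, mul_one]
        refine IsIntegral.of_pow (by norm_num : 0 < 3) ?_
        rw [← Units.val_pow_eq_pow_val, psi_pow_three, Units.val_one]
        exact isIntegral_one
      · exact isIntegral_zero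
  · exact isIntegral_zero

end Weight

/-! ### §3 The twisted `L`-series of `E^{16u}` as a theta `L`-series -/

variable {k : ℤ} {m : ℕ}

/-- `Σ_{N x = n, x ≡ 1 (3)} (u/n) ν_u((x)) e(x) = a_n(E^k)` for `k = 16u`, `u ≡ 1 (4)`, `k` sixth-power-free.
[cite: IrelandRosen1990, Ch. 18 §7 with §6 Theorem 7 (PDF pp. 304–306)] -/
theorem sum_primary_normEq_eq_lFunction_good {u : ℤ} (hu4 : u % 4 = 1) (hku : k = 16 * u)
    (h6 : ∀ q : ℕ, q.Prime → ¬ (q : ℤ) ^ 6 ∣ k) (n : ℕ) :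
    ∑ p ∈ (((Finset.Icc (-((n + 1 : ℕ) : ℤ)) (n + 1 : ℕ)) ×ˢ (Finset.Icc (-((n + 1 : ℕ) : ℤ)) (n + 1 : ℕ))).filter
          (fun p : ℤ × ℤ ↦ p.1 ^ 2 - p.1 * p.2 + p.2 ^ 2 = n)).filter (fun p : ℤ × ℤ ↦ mkInt p.1 p.2 - 1 ∈ three),
        (jacobiSym u n : ℂ) * grossenNu ((u : ℤ) : 𝓞 K3) 1 0 (Ideal.span {mkInt p.1 p.2}) * embC ((mkInt p.1 p.2 : 𝓞 K3) : K3) =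
      ((mordellCurve (k : ℚ)).LFunction n : ℂ) := by
  rw [lFunction_eq_jacobiSym_mul_sum_of_eq_sixteen_mul hu4 hku h6 n, Finset.mul_sum,
    sum_idealsOfNorm_eq_sum_primary _ (fun I hI ↦ by rw [grossenNu_eq_zero_of_not_isCoprime_three _ hI, zero_mul, mul_zero])]
  refine Finset.sum_congr rfl fun p hp ↦ ?_
  rw [Finset.mem_filter] at hp
  rw [primGen_span_singleton hp.2, mul_assoc]

/-- `Σ_{a² − ab + b² = n} W′(a + bζ) e(a + bζ) = c(n) a_n(E^k)` for `k = 16u`, `u ≡ 1 (4)`, `k` sixth-power-free.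
[cite: IrelandRosen1990, Ch. 18 §7 with §6 Theorem 7 (PDF pp. 304–306)] -/
theorem sum_normEq_weight_good_eq {u : ℤ} (hu4 : u % 4 = 1) (hku : k = 16 * u) (h6 : ∀ q : ℕ, q.Prime → ¬ (q : ℤ) ^ 6 ∣ k)
    (c : ZMod m → ℂ) (n : ℕ) :
    ∑ p ∈ ((Finset.Icc (-((n + 1 : ℕ) : ℤ)) (n + 1 : ℕ)) ×ˢ (Finset.Icc (-((n + 1 : ℕ) : ℤ)) (n + 1 : ℕ))).filter
        (fun p : ℤ × ℤ ↦ p.1 ^ 2 - p.1 * p.2 + p.2 ^ 2 = n),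
      (fun x : 𝓞 K3 ↦ if x - 1 ∈ three then c ((Ideal.absNorm (Ideal.span {x}) : ℕ) : ZMod m) *
          (jacobiSym u (Ideal.absNorm (Ideal.span {x})) : ℂ) * grossenNu ((u : ℤ) : 𝓞 K3) 1 0 (Ideal.span {x}) else 0)
        (mkInt p.1 p.2) * embC ((mkInt p.1 p.2 : 𝓞 K3) : K3) =
      c (n : ZMod m) * ((mordellCurve (k : ℚ)).LFunction n : ℂ) := by
  rw [← sum_primary_normEq_eq_lFunction_good hu4 hku h6 n, Finset.mul_sum]
  conv_rhs => rw [Finset.sum_filter]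
  refine Finset.sum_congr rfl fun p hp ↦ ?_
  rw [mem_filter_normForm] at hp
  have hN : Ideal.absNorm (Ideal.span {mkInt p.1 p.2}) = n := by
    zify; rw [absNorm_span_mkInt_cast, hp]
  simp only [hN]
  split_ifs with h1
  · ring
  · rw [zero_mul]

/-- ★ **Theorem 18.7 with Hecke's continuation for `y² = x³ + 16u`, `u ≡ 1 (4)`: `Σ_n c(n) a_n(E^k) n⁻ˢ = (4^s/2) · Θ-L_{2M}(Φ♯)(s)`** for
`re s > 3/2`, `M = 36|u|m`, `Φ(d₁, d₂) = W′(d₁ − d₂ζ)`, `Φ♯ = QuadOrder.parityLift Φ`, `Θ-L = BinaryTheta.thetaLFunction 3 (2M) · 1 (−√3 i)`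
(`k = 16u` sixth-power-free; any `c : ℤ/m → ℂ`). [cite: IrelandRosen1990, Ch. 18 §7 and §5 Theorem 6] [cite: Hecke1920, §9] -/
theorem lSeries_twist_eq_thetaLFunction_good {u : ℤ} (hu4 : u % 4 = 1) (hku : k = 16 * u)
    (h6 : ∀ q : ℕ, q.Prime → ¬ (q : ℤ) ^ 6 ∣ k) [NeZero m] (c : ZMod m → ℂ) :
    ∃ (M : ℕ) (_ : NeZero M) (_ : NeZero (2 * M)) (Φ : ℤ × ℤ → ℂ),
      M = 36 * u.natAbs * m ∧
      (∀ d : ℤ × ℤ, Φ d = (fun x : 𝓞 K3 ↦ if x - 1 ∈ three then c ((Ideal.absNorm (Ideal.span {x}) : ℕ) : ZMod m) *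
          (jacobiSym u (Ideal.absNorm (Ideal.span {x})) : ℂ) * grossenNu ((u : ℤ) : 𝓞 K3) 1 0 (Ideal.span {x}) else 0)
          (mkInt d.1 (-d.2))) ∧
      (∀ d z : ℤ × ℤ, Φ (d.1 + M * z.1, d.2 + M * z.2) = Φ d) ∧
      ((∀ a, IsIntegral ℤ (c a)) → ∀ d, IsIntegral ℤ (Φ d)) ∧
      ∀ s : ℂ, 3 / 2 < s.re →
        LSeries (fun n : ℕ ↦ c (n : ZMod m) * ((mordellCurve (k : ℚ)).LFunction n : ℂ)) s =
          (4 : ℂ) ^ s / 2 * BinaryTheta.thetaLFunction 3 (2 * M) 1 (-((Real.sqrt 3 : ℂ) * I)) (QuadOrder.parityLift Φ) s := by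
  have hu0 : u ≠ 0 := by rintro rfl; omega
  set M : ℕ := 36 * u.natAbs * m with hM
  haveI hM0 : NeZero M :=
    ⟨by rw [hM]; exact Nat.mul_ne_zero (Nat.mul_ne_zero (by norm_num) (Int.natAbs_ne_zero.mpr hu0)) (NeZero.ne m)⟩
  haveI h2M0 : NeZero (2 * M) := ⟨Nat.mul_ne_zero two_ne_zero (NeZero.ne M)⟩
  set W : 𝓞 K3 → ℂ := fun x : 𝓞 K3 ↦ if x - 1 ∈ three then c ((Ideal.absNorm (Ideal.span {x}) : ℕ) : ZMod m) *
      (jacobiSym u (Ideal.absNorm (Ideal.span {x})) : ℂ) * grossenNu ((u : ℤ) : 𝓞 K3) 1 0 (Ideal.span {x}) else 0 with hW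
  set Φ : ℤ × ℤ → ℂ := fun d : ℤ × ℤ ↦ W (mkInt d.1 (-d.2)) with hΦdef
  have hΦ : ∀ d z : ℤ × ℤ, Φ (d.1 + M * z.1, d.2 + M * z.2) = Φ d := by
    intro d z
    have h := weight_periodic_good u m c hu4 (mkInt d.1 (-d.2)) (mkInt z.1 (-z.2))
    change W (mkInt d.1 (-d.2) + ((M : ℕ) : 𝓞 K3) * mkInt z.1 (-z.2)) = W (mkInt d.1 (-d.2)) at h
    have e : mkInt d.1 (-d.2) + ((M : ℕ) : 𝓞 K3) * mkInt z.1 (-z.2) = mkInt (d.1 + M * z.1) (-(d.2 + M * z.2)) := by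
      rw [show ((M : ℕ) : 𝓞 K3) = mkInt M 0 by rw [mkInt_intCast]; push_cast; rfl, mkInt_mul, mkInt_add]
      congr 1 <;> ring
    rw [e] at h
    exact h
  refine ⟨M, hM0, h2M0, Φ, rfl, fun d ↦ rfl, hΦ, fun hc d ↦ isIntegral_weight_good u m c hc _, fun s hs ↦ ?_⟩
  rw [BinaryTheta.thetaLFunction_eq_LSeries 3 (2 * M) 1 _ _ (QuadOrder.parityLift_periodic M _ hΦ) hs, hΦdef,
    lSeries_coeff_parityLift W s, LSeries_congr (fun {n} _ ↦ sum_normEq_weight_good_eq hu4 hku h6 c n) s]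
  have h4 : (4 : ℂ) ^ s ≠ 0 := by
    rw [Ne, cpow_eq_zero_iff, not_and_or]; exact Or.inl (by norm_num)
  rw [cpow_neg]
  field_simp

end SexticTwist

end Literature.NumberTheory.EllipticCurves

end
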